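import Mathlib
import Summits.QuantumFields.YangMills.Theses.ThermodynamicCeilings

/-!
# Route `ThermodynamicCeilings` — glue of the split of `ScaleMonotonicityC` (LINE F)

`WindowedSplitGlue : WindowedSpectralMeasure → AbelWindowTransferW → ScaleMonotonicityC`: the windowed Abel transfer (pure real
analysis, a hypothesis here) instantiated on the transfer-matrix spectral measure of clause (i) of `WindowedSpectralMeasure` with
`E₀ := max (s/ℓ) (4/L)` — `E₀ ≤ 1` is forced by the K_M window `4 ≤ t ≤ t₂ ≤ min(L, 2ℓ/s+2)`, `t₂E₀ ≤ 4` — abstract times `t-δ`,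
`t₂-δ`, `T = 2L+1-2δ`, constant `A'·(4/3)⁸`.  Adapted from the landed `scaleMonotonicity_of_spectralR` (p626473).  Proves only
this implication; no summit / leaf / NT / UV / IR statement is proved here (D-0145 ideator ym-idea-11 g5, lens «wuc»).
-/

set_option autoImplicit false

namespace Summit.QuantumFields.YangMills.Theses.ThermodynamicCeilings

open MeasureTheory in
/-- closes the glue item `WindowedSplitGlue` (stmt-QuantumFields-27778) of route `ThermodynamicCeilings`. -/
theorem windowedSplitGlue_proof : WindowedSplitGlue := by
  intro hS hT
  unfold ScaleMonotonicityC Summit.QuantumFields.YangMills.Theses.AntiScreeningCeilings.ScaleMonotonicity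
  intro G _ _ _ _ hG hiso r v f g h Λ₅
  letI : MeasurableSpace G := borel G
  haveI : BorelSpace G := ⟨rfl⟩
  obtain ⟨ε₀, hε₀, hmain⟩ := hS G hG hiso r v f g h Λ₅
  refine ⟨ε₀, hε₀, fun ε hε hεε hfl => ?_⟩
  obtain ⟨ℓM, hℓM, hℓ⟩ := hmain ε hε hεε hfl
  refine ⟨ℓM, hℓM, fun ℓ hℓ0 hℓℓ => ?_⟩
  obtain ⟨A, βM, hA, hβ⟩ := hℓ ℓ hℓ0 hℓℓ
  obtain ⟨A', hA', hT⟩ := hT A hA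
  refine ⟨A' * (4 / 3 : ℝ) ^ 8, βM, ?_, fun β hββ s hs0 hs1 hwin L q k t t₂ hq ht4 htt ht₂ℓ ht₂L => ?_⟩
  · have h2 : (1:ℝ) ≤ (4 / 3 : ℝ) ^ 8 := by norm_num
    nlinarith
  obtain ⟨ν, κ₀, δ, hfin, hsupp, hκ₀, hδ, hrep, hsub, huv⟩ := hβ β hββ s hs0 hs1 hwin L q k hq
  have hE₀' : 0 < s / ℓ := div_pos hs0 hℓ0
  have ht4R : (4:ℝ) ≤ (t : ℝ) := by exact_mod_cast ht4
  have httR : (t : ℝ) ≤ (t₂ : ℝ) := by exact_mod_cast htt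
  have hδR : (δ : ℝ) ≤ 1 := by exact_mod_cast hδ
  have hδ0 : (0 : ℝ) ≤ (δ : ℝ) := Nat.cast_nonneg δ
  have ht₂LR : (t₂ : ℝ) ≤ (L : ℝ) := by exact_mod_cast ht₂L
  have hsl : s ≤ ℓ := by
    have h2 : (2:ℝ) ≤ 2 * ℓ / s := by linarith
    rw [le_div_iff₀ hs0] at h2
    linarith
  have hwin4 : (t₂ : ℝ) * (s / ℓ) ≤ 4 := by
    rw [show (t₂ : ℝ) * (s / ℓ) = (t₂ : ℝ) * s / ℓ by ring, div_le_iff₀ hℓ0]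
    have h3 : (t₂ : ℝ) * s ≤ (2 * ℓ / s + 2) * s := mul_le_mul_of_nonneg_right ht₂ℓ hs0.le
    have h4 : (2 * ℓ / s + 2) * s = 2 * ℓ + 2 * s := by field_simp
    nlinarith
  have hL0 : (0 : ℝ) < (L : ℝ) := by linarith
  have hwinL : (t₂ : ℝ) * (4 / (L : ℝ)) ≤ 4 := by
    rw [show (t₂ : ℝ) * (4 / (L : ℝ)) = (t₂ : ℝ) * 4 / (L : ℝ) by ring, div_le_iff₀ hL0]
    linarith
  have hE₀ : 0 < max (s / ℓ) (4 / (L : ℝ)) := lt_max_of_lt_left hE₀'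
  have hwinM : (t₂ : ℝ) * max (s / ℓ) (4 / (L : ℝ)) ≤ 4 := by
    rcases le_total (s / ℓ) (4 / (L : ℝ)) with hc | hc
    · rw [max_eq_right hc]; exact hwinL
    · rw [max_eq_left hc]; exact hwin4
  generalize hEdef : max (s / ℓ) (4 / (L : ℝ)) = E₀ at hsub hE₀ hwinM huv
  have ht₂4 : (4 : ℝ) ≤ (t₂ : ℝ) := le_trans ht4R httR
  have hE₀1 : E₀ ≤ 1 := by
    by_contra hc
    push Not at hc
    nlinarith
  have huv' := huv hE₀1
  have hwin4' : ((t₂ : ℝ) - δ) * E₀ ≤ 4 := by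
    have h0 : 0 ≤ (δ : ℝ) * E₀ := mul_nonneg hδ0 hE₀.le
    have : ((t₂ : ℝ) - δ) * E₀ = (t₂ : ℝ) * E₀ - δ * E₀ := by ring
    rw [this]; linarith
  have hT2 : 2 * ((t₂ : ℝ) - δ) ≤ (((2 * L + 1 : ℕ) : ℝ) - 2 * δ) := by push_cast; linarith
  have key := hT ν κ₀ E₀ (((2 * L + 1 : ℕ) : ℝ) - 2 * δ) hfin hsupp hκ₀ hE₀ hE₀1 hsub huv' ((t : ℝ) - δ) ((t₂ : ℝ) - δ)
    (by linarith) (by linarith) hT2 hwin4'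
  rw [show (((2 * L + 1 : ℕ) : ℝ) - 2 * δ - ((t : ℝ) - δ)) = (((2 * L + 1 : ℕ) : ℝ) - δ - (t : ℝ)) by ring,
    show (((2 * L + 1 : ℕ) : ℝ) - 2 * δ - ((t₂ : ℝ) - δ)) = (((2 * L + 1 : ℕ) : ℝ) - δ - (t₂ : ℝ)) by ring] at key
  have hrt := hrep t (by omega) (by omega)
  have hrt₂ := hrep t₂ (by omega) (by omega)
  have nonneg : ∀ τ : ℕ, 0 ≤ κ₀ + ∫ E, (Real.exp (-(E * ((τ : ℝ) - δ))) + Real.exp (-(E * (((2 * L + 1 : ℕ) : ℝ) - δ - (τ : ℝ))))) ∂ν :=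
    fun τ => add_nonneg hκ₀ (integral_nonneg fun E => by positivity)
  rw [hrt, hrt₂, abs_of_nonneg (nonneg t), abs_of_nonneg (nonneg t₂)]
  have hpow1 : (t : ℝ) ^ 8 ≤ (4 / 3 : ℝ) ^ 8 * ((t : ℝ) - δ) ^ 8 := by
    rw [← mul_pow]
    exact pow_le_pow_left₀ (by positivity) (by linarith) 8
  have hpow2 : ((t₂ : ℝ) - δ) ^ 8 ≤ (t₂ : ℝ) ^ 8 :=
    pow_le_pow_left₀ (by linarith) (by linarith) 8
  have hApos : 0 ≤ A' := by linarith
  calc (t : ℝ) ^ 8 * (κ₀ + ∫ E, (Real.exp (-(E * ((t : ℝ) - δ))) + Real.exp (-(E * (((2 * L + 1 : ℕ) : ℝ) - δ - (t : ℝ))))) ∂ν)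
      ≤ (4 / 3 : ℝ) ^ 8 * ((t : ℝ) - δ) ^ 8 * (κ₀ + ∫ E, (Real.exp (-(E * ((t : ℝ) - δ))) + Real.exp (-(E * (((2 * L + 1 : ℕ) : ℝ) - δ - (t : ℝ))))) ∂ν) :=
        mul_le_mul_of_nonneg_right hpow1 (nonneg t)
    _ = (4 / 3 : ℝ) ^ 8 * (((t : ℝ) - δ) ^ 8 * (κ₀ + ∫ E, (Real.exp (-(E * ((t : ℝ) - δ))) + Real.exp (-(E * (((2 * L + 1 : ℕ) : ℝ) - δ - (t : ℝ))))) ∂ν)) := by ring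
    _ ≤ (4 / 3 : ℝ) ^ 8 * (A' * ((t₂ : ℝ) - δ) ^ 8 * (κ₀ + ∫ E, (Real.exp (-(E * ((t₂ : ℝ) - δ))) + Real.exp (-(E * (((2 * L + 1 : ℕ) : ℝ) - δ - (t₂ : ℝ))))) ∂ν)) :=
        mul_le_mul_of_nonneg_left key (by positivity)
    _ ≤ (4 / 3 : ℝ) ^ 8 * (A' * (t₂ : ℝ) ^ 8 * (κ₀ + ∫ E, (Real.exp (-(E * ((t₂ : ℝ) - δ))) + Real.exp (-(E * (((2 * L + 1 : ℕ) : ℝ) - δ - (t₂ : ℝ))))) ∂ν)) := by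
        rw [mul_assoc (A'), mul_assoc (A')]
        exact mul_le_mul_of_nonneg_left (mul_le_mul_of_nonneg_left (mul_le_mul_of_nonneg_right hpow2 (nonneg t₂)) hApos) (by positivity)
    _ = A' * (4 / 3 : ℝ) ^ 8 * (t₂ : ℝ) ^ 8 * (κ₀ + ∫ E, (Real.exp (-(E * ((t₂ : ℝ) - δ))) + Real.exp (-(E * (((2 * L + 1 : ℕ) : ℝ) - δ - (t₂ : ℝ))))) ∂ν) := by ring


end Summit.QuantumFields.YangMills.Theses.ThermodynamicCeilings
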